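import Literature.Barriers.CriticalPhenomena.RigorousRGSmallParameterTorusBump
import Mathlib.RingTheory.Binomial
import Mathlib.RingTheory.Polynomial.Pochhammer
import HarnessLib

/-!
# `RigorousRGSmallParameter` (Slade, Theorem 1.4.1): the binomial test functions `binom(t,k)` on `ℤ`
# — differences, iterates, the bound `|binom(t,k)| ≤ (|t|+k)^k` — and the wrap-free transfer of
# differences to `ZMod M` ([BS-rg-loc] §3.3, towards Lemma 3.3.2)

Companion ("proof architecture") file of
`Literature/Barriers/CriticalPhenomena/RigorousRGSmallParameter.lean` (Loc norm-estimates layer).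
[BS-rg-loc] Lemma 3.3.2 (lem:TayX) bounds the localised norm `‖f_m^{(a)}‖_{Φ(X)} ≤ C̄𝔥^{-m}R^{|α(m)|₁}`
of the dual test functions, which ([BS-rg-loc] (2.3), tree `…LocDuality.binomTF`) are tensor products
of binomials `binom(z_j(x), α_j)` of the centred coordinates; the proof rests on "Taylor approximation
on the infinite lattice `ℤ^d`" transferred to the torus "by judicious restriction to a coordinate
patch … since nearest-neighbours and hence derivatives are preserved by `z`" (§3.3). This file PROVES
the one-dimensional ingredients: on `ℤ`, `Δ binom(·,k+1) = binom(·,k)` (Pascal in the binomial ring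
`ℤ`), hence `Δ^i binom(·,k) = binom(·,k-i)` (`0` for `i > k`), and `|binom(t,k)| ≤ (|t|+k)^k` from
`k!·binom(t,k) = ∏_{i<k}(t-i)`; on `ZMod M`, the POINTWISE intertwining of (mixed) differences with
the lift through the centred coordinate, valid wherever the evaluation does not wrap around the window
(no support condition, unlike `…TorusBump.iter_fwdDiffM_liftM`). All PROVED, 0 sorry:

* `chooseZ`, `fwdDiff_chooseZ_succ`, `fwdDiff_chooseZ_zero`, `iter_fwdDiff_zero`,
  **`iter_fwdDiff_chooseZ`**, **`abs_chooseZ_le`**, `abs_iter_fwdDiff_chooseZ_le`;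
* **`iter_fwdDiffM_liftM_apply`**, `valMinAbs_sub_one_of_lt`, `valMinAbs_sub_natCast`,
  **`dirDiffs_liftM_apply`** (`D_l(lift g)(y) = (-1)^{#back}(Δ^{|l|}g)(z(y) - #back)` for
  `(|z(y)| + |l| + 1)·2 ≤ M`).

Sources: D. C. Brydges, G. Slade, *A renormalisation group method. II. Approximation by local
polynomials*, J. Stat. Phys. 159 (2015) 461–491, arXiv:1403.7253, §2.1 ((2.3)) and §3.3 (Lemma 3.3.2
and the transfer paragraph), TeX-source numbering.

## References

* [BrydgesSlade2015RGII] D. C. Brydges, G. Slade, *A renormalisation group method. II.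
  Approximation by local polynomials*, J. Stat. Phys. **159** (2015) 461–491, arXiv:1403.7253.
-/

noncomputable section

namespace Literature.Barriers.CriticalPhenomena

namespace LongRangePhi4

namespace Bump

open Finset

/-! ### Binomials on `ℤ` -/

/-- `t ↦ binom(t, k)` (the binomial-ring `Ring.choose` on `ℤ`, as a real test function). [cite: BrydgesSlade2015RGII, §2.1 (display (2.3), the binomial test functions)] -/
def chooseZ (k : ℕ) : ℤ → ℝ := fun t => ((Ring.choose t k : ℤ) : ℝ)

/-- `Δ binom(·, k+1) = binom(·, k)` (Pascal). [folklore] -/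
theorem fwdDiff_chooseZ_succ (k : ℕ) : fwdDiff (chooseZ (k + 1)) = chooseZ k := by
  funext t
  simp only [fwdDiff, chooseZ, Ring.choose_succ_succ]
  push_cast; ring

/-- `Δ binom(·, 0) = 0`. [folklore] -/
theorem fwdDiff_chooseZ_zero : fwdDiff (chooseZ 0) = fun _ => 0 := by
  funext t
  simp [fwdDiff, chooseZ]

/-- `Δ^i 0 = 0`. [folklore] -/
theorem iter_fwdDiff_zero (i : ℕ) : fwdDiff^[i] (fun _ : ℤ => (0 : ℝ)) = fun _ => 0 := by
  induction i with
  | zero => rfl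
  | succ i ih => rw [Function.iterate_succ_apply, show fwdDiff (fun _ : ℤ => (0:ℝ)) = fun _ => 0 by funext t; simp [fwdDiff], ih]

/-- **`Δ^i binom(·,k) = binom(·,k-i)` for `i ≤ k`, and `0` for `i > k`.** [folklore] -/
theorem iter_fwdDiff_chooseZ : ∀ (i k : ℕ), fwdDiff^[i] (chooseZ k) = if i ≤ k then chooseZ (k - i) else fun _ => 0
  | 0, k => by simp
  | i + 1, 0 => by
      rw [Function.iterate_succ_apply, fwdDiff_chooseZ_zero, iter_fwdDiff_zero, if_neg (by omega)]
  | i + 1, k + 1 => by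
      rw [Function.iterate_succ_apply, fwdDiff_chooseZ_succ, iter_fwdDiff_chooseZ i k]
      by_cases h : i ≤ k
      · rw [if_pos h, if_pos (by omega), Nat.succ_sub_succ]
      · rw [if_neg h, if_neg (by omega)]

/-- **`|binom(t,k)| ≤ (|t| + k)^k`** (from `k!·binom(t,k) = ∏_{i<k}(t - i)`). [folklore] -/
theorem abs_chooseZ_le (k : ℕ) (t : ℤ) : |chooseZ k t| ≤ (|(t : ℝ)| + k) ^ k := by
  have hprod : ((k.factorial : ℕ) : ℝ) * chooseZ k t = ∏ i ∈ range k, ((t : ℝ) - i) := by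
    have h1 := Ring.descPochhammer_eq_factorial_smul_choose t k
    rw [← Polynomial.eval_eq_smeval, descPochhammer_eval_eq_prod_range, nsmul_eq_mul] at h1
    have h2 : ((∏ i ∈ range k, (t - (i : ℤ)) : ℤ) : ℝ) = (((k.factorial : ℤ) * Ring.choose t k : ℤ) : ℝ) := by
      exact_mod_cast h1
    unfold chooseZ
    push_cast at h2
    exact h2.symm
  have hk : (0 : ℝ) < (k.factorial : ℕ) := by exact_mod_cast Nat.factorial_pos k
  have hle : ((k.factorial : ℕ) : ℝ) * |chooseZ k t| ≤ (|(t : ℝ)| + k) ^ k := by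
    rw [← abs_of_pos hk, ← abs_mul, hprod, Finset.abs_prod]
    calc ∏ i ∈ range k, |(t : ℝ) - i| ≤ ∏ i ∈ range k, (|(t : ℝ)| + k) := by
          refine Finset.prod_le_prod (fun i _ => abs_nonneg _) fun i hi => ?_
          rw [Finset.mem_range] at hi
          have : (i : ℝ) ≤ k := by exact_mod_cast hi.le
          have hi0 : |(i : ℝ)| = i := abs_of_nonneg (Nat.cast_nonneg i)
          calc |(t : ℝ) - i| ≤ |(t : ℝ)| + |(i : ℝ)| := abs_sub _ _
            _ ≤ |(t : ℝ)| + k := by rw [hi0]; linarith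
      _ = (|(t : ℝ)| + k) ^ k := by rw [Finset.prod_const, Finset.card_range]
  have h1 : (1 : ℝ) ≤ (k.factorial : ℕ) := by exact_mod_cast Nat.one_le_iff_ne_zero.2 (Nat.factorial_ne_zero k)
  calc |chooseZ k t| = 1 * |chooseZ k t| := (one_mul _).symm
    _ ≤ ((k.factorial : ℕ) : ℝ) * |chooseZ k t| := mul_le_mul_of_nonneg_right h1 (abs_nonneg _)
    _ ≤ _ := hle

/-- **`|Δ^i binom(t,k)| ≤ (|t| + k)^{k-i}`** (and `0` if `i > k`). [folklore] -/
theorem abs_iter_fwdDiff_chooseZ_le (i k : ℕ) (t : ℤ) :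
    |fwdDiff^[i] (chooseZ k) t| ≤ if i ≤ k then (|(t : ℝ)| + k) ^ (k - i) else 0 := by
  rw [iter_fwdDiff_chooseZ]
  split_ifs with h
  · refine (abs_chooseZ_le (k - i) t).trans (pow_le_pow_left₀ (by positivity) ?_ _)
    have : ((k - i : ℕ) : ℝ) ≤ k := by exact_mod_cast Nat.sub_le k i
    linarith
  · simp

/-! ### Wrap-free transfer of differences to `ZMod M` -/

variable {M : ℕ} [NeZero M]

/-- **Pointwise intertwining without support conditions**: `Δ^i(liftM g)(y) = (Δ^i g)(z(y))` as long
as the `i` forward steps from `y` do not leave the window: `(z(y) + i)·2 ≤ M`. [folklore] -/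
theorem iter_fwdDiffM_liftM_apply (c : ZMod M) (g : ℤ → ℝ) :
    ∀ (i : ℕ) (y : ZMod M), ((y - c).valMinAbs + i) * 2 ≤ (M : ℤ) → (fwdDiffM^[i] (liftM c g)) y = (fwdDiff^[i] g) ((y - c).valMinAbs)
  | 0, y, _ => rfl
  | i + 1, y, h => by
      rw [Function.iterate_succ_apply', Function.iterate_succ_apply']
      simp only [fwdDiffM, Bump.fwdDiff]
      have hy : ((y - c).valMinAbs + i) * 2 ≤ (M : ℤ) := by push_cast at h; linarith
      have e : y + 1 - c = (y - c) + 1 := by ring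
      have hstep : (y + 1 - c).valMinAbs = (y - c).valMinAbs + 1 := by
        rw [e]; exact valMinAbs_add_one_of_le _ (by push_cast at h; linarith)
      rw [iter_fwdDiffM_liftM_apply c g i y hy, iter_fwdDiffM_liftM_apply c g i (y + 1) (by rw [hstep]; push_cast at h ⊢; linarith),
        hstep]

/-- The centred coordinate steps by `-1` away from the left end of the window. [folklore] -/
theorem valMinAbs_sub_one_of_lt (i : ZMod M) (h : -(M : ℤ) < (i.valMinAbs - 1) * 2) :
    (i - 1).valMinAbs = i.valMinAbs - 1 := by
  have hi := i.valMinAbs_mem_Ioc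
  rw [ZMod.valMinAbs_spec]
  exact ⟨by simp [ZMod.coe_valMinAbs], h, by linarith [hi.2]⟩

/-- Iterated: `z(y - b) = z(y) - b` when `-(M) < (z(y) - b)·2`. [folklore] -/
theorem valMinAbs_sub_natCast (c y : ZMod M) : ∀ b : ℕ, -(M : ℤ) < ((y - c).valMinAbs - b) * 2 →
    (y - (b : ZMod M) - c).valMinAbs = (y - c).valMinAbs - b
  | 0, _ => by simp
  | b + 1, h => by
      have hb : -(M : ℤ) < ((y - c).valMinAbs - b) * 2 := by push_cast at h; linarith
      have ih := valMinAbs_sub_natCast c y b hb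
      have e : y - ((b + 1 : ℕ) : ZMod M) - c = (y - (b : ZMod M) - c) - 1 := by push_cast; ring
      rw [e, valMinAbs_sub_one_of_lt _ (by rw [ih]; push_cast at h ⊢; linarith), ih]
      push_cast; ring

/-- **Mixed differences of a lifted function, pointwise**: for `|z(y)| + |l| < M/2` (so that no shift
in the evaluation wraps around), `D_l(liftM g)(y) = (-1)^{#back}(Δ^{|l|}g)(z(y) - #back)`. [folklore] -/
theorem dirDiffs_liftM_apply (c : ZMod M) (g : ℤ → ℝ) (l : List Bool) (y : ZMod M)
    (h : (|(y - c).valMinAbs| + l.length + 1) * 2 ≤ (M : ℤ)) :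
    dirDiffs l (liftM c g) y = (-1 : ℝ) ^ (l.count false) * (fwdDiff^[l.length] g) ((y - c).valMinAbs - (l.count false : ℕ)) := by
  rw [dirDiffs_eq]
  simp only
  congr 1
  have hcnt : l.count false ≤ l.length := List.count_le_length
  have habs := abs_le.1 (le_refl |(y - c).valMinAbs|)
  have hcoord : (y - ((l.count false : ℕ) : ZMod M) - c).valMinAbs = (y - c).valMinAbs - (l.count false : ℕ) := by
    refine valMinAbs_sub_natCast c y _ ?_
    have : ((l.count false : ℕ) : ℤ) ≤ l.length := by exact_mod_cast hcnt
    nlinarith [habs.1, habs.2, abs_nonneg ((y - c).valMinAbs)]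
  have e : y - ((l.count false : ℕ) : ZMod M) = y - (l.count false : ℕ) := rfl
  rw [iter_fwdDiffM_liftM_apply c g l.length (y - ((l.count false : ℕ) : ZMod M)) ?_, hcoord]
  rw [hcoord]
  have : ((l.count false : ℕ) : ℤ) ≤ l.length := by exact_mod_cast hcnt
  nlinarith [habs.1, habs.2, abs_nonneg ((y - c).valMinAbs)]

end Bump

end LongRangePhi4

end Literature.Barriers.CriticalPhenomena
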